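/-
Copyright (c) 2026 the pub-hodgecm-mathlib formalisation cell (harness21).  Prover seat hodgecm-mathlib-K2Liu-p02 (g7), Track B «K2-LIT» ∕ hLiu418
#184♮, Road Φ ∕ socket #41, organ G5-a (Φ7-2), face (β0), sub-organ (β0-1a) FILE C — THE DISCHARGE of the unfolding identity `hunfold` of ★ p859905
`K2LiuMiddleInnerSectionBorelLaw.inner_law_of_unfold` (LEAD F0P6-plan (g14) RULING «M-158d» (2), BATCH #5∕#6; K2Liu-p10 (g3) census 11:00:01Z; K2Liu-p14 (g2)
census 11:42:27Z; K2Liu-p02 (g7) census 11:59Z «=»).  THEOREMS ONLY.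
-/
import Summits.HodgeConjecture.HodgeConjecture.Theorems.K2LiuCoveringWeightSemidirectUnfold   -- ★ FILE A p860018
import Summits.HodgeConjecture.HodgeConjecture.Theorems.K2LiuUnipDeltaCornerCoordinates       -- FILE B p860079: `exists_cornerSubgroup`, corner algebra
import Summits.HodgeConjecture.HodgeConjecture.Theorems.K2LiuConstantTermMiddleCellOrbits     -- ★ α2d-2 `stabilizer_reflStd_iff`
import Summits.HodgeConjecture.HodgeConjecture.Theorems.K2LiuSiegelUnipotentHaarPinned        -- ★ `locallyCompactSpace_unipDelta`, `secondCountableTopology_unipDelta`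
import HarnessLib

/-!
# Crux `HLiu418`, Road Φ, face (β0-1a), FILE C: THE INNER SECTION OF THE MIDDLE CELL UNFOLDS ALONG THE CORNER LINE —
# `∫_{N_Δ(𝔸)} β₁(u) • φ(u y) dνN(u) = C • ∫_{𝔸_{L⁺}} φ(n₂(t) y) dμ(t)` for every `N_χ(𝔸)`-invariant continuous `φ` and every `N_χ(L⁺)`-covering weight `β₁`

Cell `hodgecm-mathlib`, crux item hLiu418 = `stmt-HodgeConjecture-24832`; squad K2 ∕ K2Liu; prover K2Liu-p02 (g7).  THEOREMS ONLY (no `def`, no instance, no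
notation, no named-fact hypothesis, no `sorry`); lane `--supports stmt-HodgeConjecture-24832 --as helper`.

THE STATEMENT (`n = 2`, the datum of #41; frame `g₀∕hg₀`, `Λ∕hΛ` of ★ α2b∕α2c exactly as in ★ α3-2 `K2LiuConstantTermMiddleCellGL2`).  Let `νN` be a Haar measure on `N_Δ(𝔸)`
and `μ` an additive Haar measure on `𝔸_{L⁺}`.  **`exists_corner_unfold`**: there are the corner one-parameter subgroup `n₂ : 𝔸_{L⁺} → N_Δ(𝔸)` (continuous, additive,
rational, frame coordinate `single 1 1 ((t⊗1)δ)` — FILE B `exists_cornerSubgroup`) and ONE constant `C ∈ (0, ∞)` such that for EVERY subgroup `Γ₀` with the membership law of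
★ α3-2 (`u ∈ Γ₀ ↔ u ∈ H(L⁺) ∧ w₀ u w₀⁻¹ ∈ P_Δ`, i.e. `Γ₀ = N_χ(L⁺)`), EVERY `Γ₀`-covering weight `β₁`, EVERY continuous `φ : H(𝔸) → E` (Banach `E`) invariant under left
multiplication by `N_χ(𝔸) = {z ∈ N_Δ(𝔸) : w₀ z w₀⁻¹ ∈ P_Δ}`, and EVERY `y ∈ H(𝔸)`: `u ↦ β₁(u) • φ(u y)` is `νN`-integrable IFF `t ↦ φ(n₂(t) y)` is `μ`-integrable, and
**`∫ β₁(u) • φ(u y) dνN(u) = C • ∫ φ(n₂(t) y) dμ(t)`** (both sides vanish off integrability).  With `φ := f(w₀ ·)` for a Siegel section `f` this is LITERALLY the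
hypothesis `hunfold : F y = c · ∫ f(w₀ n₂(t) y) dμ(t)` (`c = C.toReal`) of ★ `inner_law_of_unfold` for α3-2's inner section `F y = ∫ β₁(u) • f(w₀ (u y)) dνN(u)`; the
`N_χ(𝔸)`-invariance of `f(w₀ ·)` is the consumer's `hZ` (`w₀ z w₀⁻¹ ∈ P_Δ` with trivial inducing character).

THE PROOF = ★ FILE A at `B := N_Δ(𝔸)`: §1 `exists_cornerHom` — the CORNER HOMOMORPHISM `κ : N_Δ(𝔸) →* 𝔸_L`, `u ↦ (X_u)₁₁` (★ `toBlocks₁₂_blk_mul`), continuous; its kernel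
`Z = N_χ(𝔸)` (★ α2d-2 `stabilizer_reflStd_iff`); §0 `isHaarMeasure_map_of_homeomorph_add` — Haar transport along the additive-to-multiplicative homeomorphism `𝔸_{L⁺} ≃ₜ A`,
`A = n₂(𝔸_{L⁺})`; §2 the HEAD: the continuous RETRACTION `ρ = n₂ ∘ im ∘ κ` (FILE B `baseChange_im_mul_delta`, `conjAdele_toBlocks₁₂_diag_eq_neg`) gives `A × Z ≃ₜ N_Δ(𝔸)` (FILE A
`exists_homeomorph_isTopSemidirect_of_retraction`; `N_Δ(𝔸)` is commutative, ★ `mul_comm_of_mem_unipDelta`); COCOMPACTNESS of `Γ₀ = N_Δ(L⁺) ⊓ Z` in `Z` (★ (C0)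
`exists_isCompact_cover_unipDelta` + FILE A `exists_isCompact_cover_inf_of_cover`, finiteness from ★ `finite_ratH_inter` through `ρ`) ⇒ a `Γ₀`-weight of finite mass on `Z`
(FILE A `exists_isCoveringWeight_lintegral_ne_top`; orbit-finiteness ★ `finite_unipDeltaRat_smul_mem`) ⇒ FILE A `exists_unfolding_constant`.
References: [MoeglinWaldspurger1995] II.1.7 (constant terms along `w⁻¹Pw ∩ N`), II.1.6 («as `U'(k)∖U'(𝔸)` is compact»); [KudlaRallis1994] §2 (2.10)–(2.12);
[GelbartPiatetskishapiroRallis1987] Part A §2; [Weil1940] §9; Bourbaki *Intégration* VII §2.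
HONEST LABEL.  Count-neutral helper: `HC_CM` is proved only modulo the 7 printed citations (2 remaining named inputs: hLiu418 = `stmt-HodgeConjecture-24832`,
h413 = `stmt-HodgeConjecture-24833`) until rung 0 closes.
-/

set_option autoImplicit false
set_option linter.dupNamespace false -- the mandated namespace repeats `HodgeConjecture.HodgeConjecture`

noncomputable section

open scoped Matrix ENNReal NNReal
open NumberField IsDedekindDomain MeasureTheory MeasureTheory.Measure Filter Set Function Topology
open Literature.NumberTheory.Automorphic Literature.NumberTheory.Automorphic.UnitaryGroup Literature.NumberTheory.GaloisRepresentations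
open Literature.NumberTheory.GelbartRogawski1991 Literature.NumberTheory.GelbartRogawski1991.GRConstruction
open Literature.NumberTheory.K2Lit.SiegelDoubled Literature.MeasureTheory.Group
open Literature.NumberTheory.GelbartRogawski1991.AdaptedBlocks
open UnitaryDualPair
open Summit.HodgeConjecture.HodgeConjecture.Cruxes.HLiu418.K2LiuCoveringWeightSemidirectUnfold
open Summit.HodgeConjecture.HodgeConjecture.Cruxes.HLiu418.K2LiuUnipDeltaCornerCoordinates
open Summit.HodgeConjecture.HodgeConjecture.Cruxes.HLiu418.K2LiuSiegelUnipotentCharacters (toBlocks₁₂_blk_mul toBlocks₁₂_blk_one toBlocks₁₂_blk_inv continuous_toBlocks₁₂_blk)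
open Summit.HodgeConjecture.HodgeConjecture.Cruxes.HLiu418.K2LiuConstantTermMiddleCellOrbits (stabilizer_reflStd_iff)
open Summit.HodgeConjecture.HodgeConjecture.Cruxes.HLiu418.K2LiuSiegelUnipotentHaarPinned (locallyCompactSpace_unipDelta secondCountableTopology_unipDelta)
open Summit.HodgeConjecture.HodgeConjecture.Cruxes.HLiu418.K2LiuUnipotentCocompact (exists_isCompact_cover_unipDelta)
open Summit.HodgeConjecture.HodgeConjecture.Cruxes.HLiu418.K2LiuUnipotentCoveringWeight (countable_unipDeltaRat finite_unipDeltaRat_smul_mem)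
open Summit.HodgeConjecture.HodgeConjecture.Cruxes.HLiu418.K2LiuSiegelDoubledRationalMultiplicity (finite_ratH_inter)

namespace Summit.HodgeConjecture.HodgeConjecture.Cruxes.HLiu418.K2LiuMiddleInnerSectionUnfold

/-! ## §0 Haar transport along an additive-to-multiplicative homeomorphism -/

/-- **an additive Haar measure pushed along a homeomorphism `T ≃ₜ G` turning `+` into `·` is a Haar measure** (left invariance from `e(s + t) = e s · e t`; finiteness on compacts and
positivity on opens transported along the homeomorphism). [cite: DeitmarEchterhoff2014, §1.5 Thm. 1.5.3] -/
theorem isHaarMeasure_map_of_homeomorph_add {T : Type*} [AddCommGroup T] [TopologicalSpace T] [IsTopologicalAddGroup T] [MeasurableSpace T] [BorelSpace T]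
    (μ : Measure T) [μ.IsAddHaarMeasure] {G : Type*} [Group G] [TopologicalSpace G] [IsTopologicalGroup G] [T2Space G] [MeasurableSpace G] [BorelSpace G]
    (eq : T ≃ₜ G) (he : ∀ s t, eq (s + t) = eq s * eq t) : IsHaarMeasure (μ.map eq) := by
  have hem : Measurable eq := eq.continuous.measurable
  haveI : (μ.map eq).IsMulLeftInvariant := by
    refine ⟨fun g => ?_⟩
    obtain ⟨s, rfl⟩ := eq.surjective g
    rw [map_map (measurable_const_mul _) hem]
    have hcomp : ((fun x => eq s * x) ∘ eq) = eq ∘ fun t => s + t := funext fun t => (he s t).symm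
    rw [hcomp, ← map_map hem (measurable_const_add s), map_add_left_eq_self]
  refine { lt_top_of_isCompact := fun K hK => ?_, open_pos := fun U hU hne => ?_ }
  · rw [map_apply hem hK.measurableSet]
    exact (eq.isCompact_preimage.2 hK).measure_lt_top
  · rw [map_apply hem hU.measurableSet]
    exact (hU.preimage eq.continuous).measure_ne_zero μ (hne.preimage eq.surjective)

variable (L : Type) [Field L] [NumberField L] [IsCMField L]
variable {N M : ℕ} (e : Fin N × Fin M ≃ Fin 2)
  (dV : Fin N → L) (hdV : ∀ i, IsCMField.complexConj L (dV i) = dV i)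
  (dW : Fin M → L) (hdW : ∀ i, IsCMField.complexConj L (dW i) = dW i)

/-! ## §1 The corner homomorphism `κ : N_Δ(𝔸) →* 𝔸_L`, `u ↦ (X_u)₁₁` -/

/-- **THE CORNER HOMOMORPHISM**: `u ↦ (X_u)₁₁` is a continuous homomorphism `N_Δ(𝔸) →* (𝔸_L, +)` (written multiplicatively), by ★ `toBlocks₁₂_blk_mul` (`X_{uv} = X_u + X_v`) and ★
`continuous_toBlocks₁₂_blk`. [cite: GelbartPiatetskishapiroRallis1987, Part A §1] [cite: MoeglinWaldspurger1995, II.1.7] -/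
theorem exists_cornerHom :
    ∃ κ : unipDelta L e dV hdV dW hdW →* Multiplicative (AdeleRing (𝓞 L) L),
      Continuous κ ∧ ∀ u, κ u = Multiplicative.ofAdd ((blk L e dV hdV dW hdW (u : HA L e dV hdV dW hdW)).toBlocks₁₂ 1 1) := by
  refine ⟨{ toFun := fun u => Multiplicative.ofAdd ((blk L e dV hdV dW hdW (u : HA L e dV hdV dW hdW)).toBlocks₁₂ 1 1)
            map_one' := ?_
            map_mul' := fun u v => ?_ }, ?_, fun u => rfl⟩
  · show Multiplicative.ofAdd ((blk L e dV hdV dW hdW ((1 : unipDelta L e dV hdV dW hdW) : HA L e dV hdV dW hdW)).toBlocks₁₂ 1 1) = 1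
    rw [OneMemClass.coe_one, toBlocks₁₂_blk_one, Matrix.zero_apply, ofAdd_zero]
  · show Multiplicative.ofAdd ((blk L e dV hdV dW hdW ((u * v : unipDelta L e dV hdV dW hdW) : HA L e dV hdV dW hdW)).toBlocks₁₂ 1 1) =
      Multiplicative.ofAdd ((blk L e dV hdV dW hdW (u : HA L e dV hdV dW hdW)).toBlocks₁₂ 1 1) *
        Multiplicative.ofAdd ((blk L e dV hdV dW hdW (v : HA L e dV hdV dW hdW)).toBlocks₁₂ 1 1)
    rw [Subgroup.coe_mul, toBlocks₁₂_blk_mul L e dV hdV dW hdW u.2 v.2, Matrix.add_apply, ofAdd_add]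
  · exact continuous_ofAdd.comp (((continuous_toBlocks₁₂_blk L e dV hdV dW hdW).comp continuous_subtype_val).matrix_elem 1 1)

/-! ## §2 THE HEAD: the inner section unfolds along the corner line -/

set_option maxHeartbeats 1600000 in -- one long assembly over the doubled unitary carriers
/-- **(β0-1a) THE UNFOLDING OF THE INNER SECTION OF THE MIDDLE CELL ALONG THE CORNER LINE.**  See the module docstring: for a Haar measure `νN` on `N_Δ(𝔸)` and an additive Haar
measure `μ` on `𝔸_{L⁺}` there are the corner one-parameter subgroup `n₂` and `C ∈ (0, ∞)` with
`∫ β₁(u) • φ(u y) dνN(u) = C • ∫ φ(n₂(t) y) dμ(t)` (and the equivalence of the two integrabilities) for every `N_χ(L⁺)`-covering weight `β₁`, every continuous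
`N_χ(𝔸)`-invariant `φ` and every `y` — the `hunfold` of ★ `K2LiuMiddleInnerSectionBorelLaw.inner_law_of_unfold` at `φ = f(w₀ ·)`.
[cite: MoeglinWaldspurger1995, II.1.7] [cite: KudlaRallis1994, §2 (2.10)–(2.12)] [cite: GelbartPiatetskishapiroRallis1987, Part A §2] -/
theorem exists_corner_unfold (hdV0 : ∀ i, dV i ≠ 0) (hdW0 : ∀ i, dW i ≠ 0)
    {g₀ : UnitaryGroup.rationalPair (Fp L) L (IsCMField.complexConj L) N M (Matrix.diagonal dV) (Matrix.diagonal dW)}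
    (hg₀ : ((g₀ : GL (Fin N × Fin M) L) : Matrix (Fin N × Fin M) (Fin N × Fin M) L) = Matrix.diagonal (fun k => 1 - 2 * (![0, 1] : Fin 2 → L) (e k)))
    (Λ : GL (Fin 2) (AdeleRing (𝓞 L) L) →* HA L e dV hdV dW hdW)
    (hΛ : ∀ g : GL (Fin 2) (AdeleRing (𝓞 L) L), blk L e dV hdV dW hdW (Λ g) =
      cayR (AdeleRing (𝓞 L) L) (Fin 2) * Matrix.fromBlocks (g : Matrix (Fin 2) (Fin 2) (AdeleRing (𝓞 L) L)) 0 0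
        (((gramR L e dV hdV dW hdW).map ((algebraMap L (AdeleRing (𝓞 L) L)).comp (algebraMap (Fp L) L)))⁻¹ *
          (((g⁻¹ : GL (Fin 2) (AdeleRing (𝓞 L) L)) : Matrix (Fin 2) (Fin 2) (AdeleRing (𝓞 L) L)).map
            (conjAdele (Fp L) L (IsCMField.complexConj L)))ᵀ *
          (gramR L e dV hdV dW hdW).map ((algebraMap L (AdeleRing (𝓞 L) L)).comp (algebraMap (Fp L) L))) *
        cayRinv (AdeleRing (𝓞 L) L) (Fin 2))
    [MeasurableSpace (unipDelta L e dV hdV dW hdW)] [BorelSpace (unipDelta L e dV hdV dW hdW)]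
    (νN : Measure (unipDelta L e dV hdV dW hdW)) [IsHaarMeasure νN]
    [MeasurableSpace (AdeleRing (𝓞 (Fp L)) (Fp L))] [BorelSpace (AdeleRing (𝓞 (Fp L)) (Fp L))]
    (μ : Measure (AdeleRing (𝓞 (Fp L)) (Fp L))) [μ.IsAddHaarMeasure] :
    ∃ (n₂ : AdeleRing (𝓞 (Fp L)) (Fp L) → HA L e dV hdV dW hdW) (C : ℝ≥0∞), C ≠ 0 ∧ C ≠ ∞ ∧
      Continuous n₂ ∧ (∀ s t, n₂ (s + t) = n₂ s * n₂ t) ∧ (∀ t, n₂ t ∈ unipDelta L e dV hdV dW hdW) ∧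
      (∀ t, (blk L e dV hdV dW hdW (n₂ t)).toBlocks₁₂ =
        Matrix.single (1 : Fin 2) (1 : Fin 2) (AdeleRing.baseChange (Fp L) L t * algebraMap L (AdeleRing (𝓞 L) L) (imagUnit L))) ∧
      (∀ t : Fp L, n₂ (algebraMap (Fp L) (AdeleRing (𝓞 (Fp L)) (Fp L)) t) ∈ ratH L e dV hdV dW hdW) ∧
      ∀ (Γ₀ : Subgroup (unipDelta L e dV hdV dW hdW))
        (_ : ∀ u : unipDelta L e dV hdV dW hdW, u ∈ Γ₀ ↔ (u : HA L e dV hdV dW hdW) ∈ ratH L e dV hdV dW hdW ∧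
          IsSiegelDelta L e dV hdV dW hdW
            (iotaGG L e dV hdV dW hdW (1, UnitaryGroup.rationalPairToAdelic (Fp L) L (IsCMField.complexConj L) N M (Matrix.diagonal dV) (Matrix.diagonal dW) g₀) *
              (u : HA L e dV hdV dW hdW) *
              (iotaGG L e dV hdV dW hdW (1, UnitaryGroup.rationalPairToAdelic (Fp L) L (IsCMField.complexConj L) N M (Matrix.diagonal dV) (Matrix.diagonal dW) g₀))⁻¹))
        (β₁ : unipDelta L e dV hdV dW hdW → ℝ≥0∞) (_ : IsCoveringWeight Γ₀ β₁)
        {E : Type*} [NormedAddCommGroup E] [NormedSpace ℝ E] [CompleteSpace E] (φ : HA L e dV hdV dW hdW → E) (_ : Continuous φ)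
        (_ : ∀ z : HA L e dV hdV dW hdW, z ∈ unipDelta L e dV hdV dW hdW →
          IsSiegelDelta L e dV hdV dW hdW
            (iotaGG L e dV hdV dW hdW (1, UnitaryGroup.rationalPairToAdelic (Fp L) L (IsCMField.complexConj L) N M (Matrix.diagonal dV) (Matrix.diagonal dW) g₀) * z *
              (iotaGG L e dV hdV dW hdW (1, UnitaryGroup.rationalPairToAdelic (Fp L) L (IsCMField.complexConj L) N M (Matrix.diagonal dV) (Matrix.diagonal dW) g₀))⁻¹) →
          ∀ h, φ (z * h) = φ h)
        (y : HA L e dV hdV dW hdW),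
        (Integrable (fun u : unipDelta L e dV hdV dW hdW => (β₁ u).toReal • φ ((u : HA L e dV hdV dW hdW) * y)) νN ↔
            Integrable (fun t => φ (n₂ t * y)) μ) ∧
          ∫ u, (β₁ u).toReal • φ ((u : HA L e dV hdV dW hdW) * y) ∂νN = C.toReal • ∫ t, φ (n₂ t * y) ∂μ := by
  classical
  -- `𝔸_L` is Hausdorff (Mathlib instances on `L_∞ × 𝔸_L^∞`, as in ★ `K2LiuSiegelUnipotentHaarPinned`)
  haveI : T2Space (InfiniteAdeleRing L) := inferInstanceAs (T2Space ((v : InfinitePlace L) → v.Completion))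
  haveI : T2Space (FiniteAdeleRing (𝓞 L) L) :=
    inferInstanceAs (T2Space (RestrictedProduct (fun v : HeightOneSpectrum (𝓞 L) => v.adicCompletion L)
      (fun v => (v.adicCompletionIntegers L : Set (v.adicCompletion L))) Filter.cofinite))
  haveI : T2Space (AdeleRing (𝓞 L) L) := inferInstanceAs (T2Space (InfiniteAdeleRing L × FiniteAdeleRing (𝓞 L) L))
  haveI : T1Space (Multiplicative (AdeleRing (𝓞 L) L)) := inferInstanceAs (T1Space (AdeleRing (𝓞 L) L))
  -- instances on `B := N_Δ(𝔸)`
  haveI : LocallyCompactSpace (unipDelta L e dV hdV dW hdW) := locallyCompactSpace_unipDelta L e dV hdV dW hdW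
  haveI : SecondCountableTopology (unipDelta L e dV hdV dW hdW) := secondCountableTopology_unipDelta L e dV hdV dW hdW
  haveI : Countable (unipDeltaRat L e dV hdV dW hdW) := countable_unipDeltaRat L e dV hdV dW hdW
  have hcommB : ∀ u v : unipDelta L e dV hdV dW hdW, u * v = v * u := fun u v => Subtype.ext (mul_comm_of_mem_unipDelta L e dV hdV dW hdW u.2 v.2)
  -- the corner subgroup (FILE B) and the corner homomorphism (§1)
  obtain ⟨n₂, hn₂c, hn₂add, hn₂0, hn₂mem, hn₂X, hn₂rat, -⟩ := exists_cornerSubgroup L e dV hdV dW hdW hdV0 hdW0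
  obtain ⟨κ, hκc, hκ⟩ := exists_cornerHom L e dV hdV dW hdW
  have hker : ∀ u : unipDelta L e dV hdV dW hdW, u ∈ κ.ker ↔ (blk L e dV hdV dW hdW (u : HA L e dV hdV dW hdW)).toBlocks₁₂ 1 1 = 0 := fun u => by
    rw [MonoidHom.mem_ker, hκ u, ofAdd_eq_one]
  have hZlaw : ∀ u : unipDelta L e dV hdV dW hdW, u ∈ κ.ker ↔
      IsSiegelDelta L e dV hdV dW hdW
        (iotaGG L e dV hdV dW hdW (1, UnitaryGroup.rationalPairToAdelic (Fp L) L (IsCMField.complexConj L) N M (Matrix.diagonal dV) (Matrix.diagonal dW) g₀) *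
          (u : HA L e dV hdV dW hdW) *
          (iotaGG L e dV hdV dW hdW (1, UnitaryGroup.rationalPairToAdelic (Fp L) L (IsCMField.complexConj L) N M (Matrix.diagonal dV) (Matrix.diagonal dW) g₀))⁻¹) :=
    fun u => by rw [hker, stabilizer_reflStd_iff hg₀ Λ hΛ u.2]
  -- `n₂` into `B`, the coordinate `im`, and the retraction `ρ₀ = n₂ ∘ im ∘ κ`
  let n₂B : AdeleRing (𝓞 (Fp L)) (Fp L) → unipDelta L e dV hdV dW hdW := fun t => ⟨n₂ t, hn₂mem t⟩
  have hn₂Bc : Continuous n₂B := hn₂c.subtype_mk _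
  have hn₂Badd : ∀ s t, n₂B (s + t) = n₂B s * n₂B t := fun s t => Subtype.ext (hn₂add s t)
  have hn₂B0 : n₂B 0 = 1 := Subtype.ext hn₂0
  let im : AdeleRing (𝓞 L) L → AdeleRing (𝓞 (Fp L)) (Fp L) := fun x =>
    ((quadraticAdeleEquiv (Fp L) L (IsCMField.complexConj L) (complexConj_imagUnit L) (imagUnit_ne_zero L)).symm x).2
  have himc : Continuous im := continuous_im L
  have hX11n₂ : ∀ t, (blk L e dV hdV dW hdW (n₂ t)).toBlocks₁₂ 1 1 = AdeleRing.baseChange (Fp L) L t * algebraMap L (AdeleRing (𝓞 L) L) (imagUnit L) := fun t => by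
    rw [hn₂X, Matrix.single_apply_same]
  have him_n₂ : ∀ t, im ((blk L e dV hdV dW hdW (n₂ t)).toBlocks₁₂ 1 1) = t := fun t => by
    rw [hX11n₂]
    exact im_baseChange_mul_delta L t
  let ρ₀ : unipDelta L e dV hdV dW hdW → unipDelta L e dV hdV dW hdW := fun u => n₂B (im ((blk L e dV hdV dW hdW (u : HA L e dV hdV dW hdW)).toBlocks₁₂ 1 1))
  have hX11c : Continuous fun u : unipDelta L e dV hdV dW hdW => (blk L e dV hdV dW hdW (u : HA L e dV hdV dW hdW)).toBlocks₁₂ 1 1 :=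
    ((continuous_toBlocks₁₂_blk L e dV hdV dW hdW).comp continuous_subtype_val).matrix_elem 1 1
  have hρ₀c : Continuous ρ₀ := hn₂Bc.comp (himc.comp hX11c)
  have hρ₀n₂ : ∀ t, ρ₀ (n₂B t) = n₂B t := fun t => by
    show n₂B (im ((blk L e dV hdV dW hdW (n₂ t)).toBlocks₁₂ 1 1)) = n₂B t
    rw [him_n₂]
  have hX11ρ₀ : ∀ u : unipDelta L e dV hdV dW hdW,
      (blk L e dV hdV dW hdW (ρ₀ u : HA L e dV hdV dW hdW)).toBlocks₁₂ 1 1 = (blk L e dV hdV dW hdW (u : HA L e dV hdV dW hdW)).toBlocks₁₂ 1 1 := fun u => by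
    show (blk L e dV hdV dW hdW (n₂ (im _))).toBlocks₁₂ 1 1 = _
    rw [hX11n₂]
    exact baseChange_im_mul_delta L (conjAdele_toBlocks₁₂_diag_eq_neg L e dV hdV dW hdW hdV0 hdW0 u.2 1)
  -- the corner line `A = n₂(𝔸_{L⁺})` (a subgroup = the fixed points of `ρ₀`) and the kernel `Z = N_χ(𝔸)`
  let n₂H : Multiplicative (AdeleRing (𝓞 (Fp L)) (Fp L)) →* unipDelta L e dV hdV dW hdW :=
    { toFun := fun t => n₂B (Multiplicative.toAdd t)
      map_one' := hn₂B0
      map_mul' := fun s t => hn₂Badd _ _ }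
  set A : Subgroup (unipDelta L e dV hdV dW hdW) := n₂H.range with hAdef
  have hmemA : ∀ u, u ∈ A ↔ ∃ t, n₂B t = u := fun u =>
    ⟨fun ⟨t, ht⟩ => ⟨Multiplicative.toAdd t, ht⟩, fun ⟨t, ht⟩ => ⟨Multiplicative.ofAdd t, ht⟩⟩
  have hAfix : ∀ u, u ∈ A ↔ ρ₀ u = u := fun u => by
    rw [hmemA]
    constructor
    · rintro ⟨t, rfl⟩
      exact hρ₀n₂ t
    · intro h
      exact ⟨_, h⟩
  have hAc : IsClosed (A : Set (unipDelta L e dV hdV dW hdW)) := by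
    rw [show (A : Set (unipDelta L e dV hdV dW hdW)) = {u | ρ₀ u = u} from Set.ext hAfix]
    exact isClosed_eq hρ₀c continuous_id
  set Z : Subgroup (unipDelta L e dV hdV dW hdW) := κ.ker with hZdef
  have hZc : IsClosed (Z : Set (unipDelta L e dV hdV dW hdW)) := by
    rw [hZdef, MonoidHom.coe_ker]
    exact isClosed_singleton.preimage hκc
  let ρ : unipDelta L e dV hdV dW hdW → A := fun u => ⟨ρ₀ u, (hmemA _).2 ⟨_, rfl⟩⟩
  have hρc : Continuous ρ := hρ₀c.subtype_mk _
  have hρ : ∀ (a : A) (z : Z), ρ ((a : unipDelta L e dV hdV dW hdW) * z) = a := fun a z => by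
    obtain ⟨t, ht⟩ := (hmemA a).1 a.2
    apply Subtype.ext
    show n₂B (im ((blk L e dV hdV dW hdW (((a : unipDelta L e dV hdV dW hdW) * (z : unipDelta L e dV hdV dW hdW) : unipDelta L e dV hdV dW hdW) :
      HA L e dV hdV dW hdW)).toBlocks₁₂ 1 1)) = a
    rw [Subgroup.coe_mul, toBlocks₁₂_blk_mul L e dV hdV dW hdW (a : unipDelta L e dV hdV dW hdW).2 (z : unipDelta L e dV hdV dW hdW).2, Matrix.add_apply,
      (hker _).1 z.2, add_zero, ← ht, him_n₂]
  have hρZ : ∀ b : unipDelta L e dV hdV dW hdW, ((ρ b : unipDelta L e dV hdV dW hdW))⁻¹ * b ∈ Z := fun b => by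
    refine (hker _).2 ?_
    rw [Subgroup.coe_mul, Subgroup.coe_inv, toBlocks₁₂_blk_mul L e dV hdV dW hdW (inv_mem (ρ₀ b).2) b.2, toBlocks₁₂_blk_inv L e dV hdV dW hdW (ρ₀ b).2,
      Matrix.add_apply, Matrix.neg_apply, hX11ρ₀, neg_add_cancel]
  have hnorm : ∀ (a : A) (z : Z), (a : unipDelta L e dV hdV dW hdW)⁻¹ * (z : unipDelta L e dV hdV dW hdW) * a ∈ Z := fun a z => by
    rw [hcommB _ (a : unipDelta L e dV hdV dW hdW), ← mul_assoc, mul_inv_cancel, one_mul]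
    exact z.2
  have hAZ : ∀ (a : A) (z : Z), (a : unipDelta L e dV hdV dW hdW) * z = (z : unipDelta L e dV hdV dW hdW) * a := fun a z => hcommB _ _
  obtain ⟨eAZ, hsd⟩ := exists_homeomorph_isTopSemidirect_of_retraction A Z ρ hρc hρ hρZ hAc hZc hnorm
  -- measures: Haar on `Z`; `μ` transported to `A` along `𝔸_{L⁺} ≃ₜ A`
  haveI : LocallyCompactSpace Z := hZc.locallyCompactSpace
  let μZ : Measure Z := Measure.haar
  let eA : AdeleRing (𝓞 (Fp L)) (Fp L) ≃ₜ A :=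
    { toFun := fun t => ⟨n₂B t, (hmemA _).2 ⟨t, rfl⟩⟩
      invFun := fun a => im ((blk L e dV hdV dW hdW ((a : unipDelta L e dV hdV dW hdW) : HA L e dV hdV dW hdW)).toBlocks₁₂ 1 1)
      left_inv := fun t => him_n₂ t
      right_inv := fun a => Subtype.ext ((hAfix a).1 a.2)
      continuous_toFun := hn₂Bc.subtype_mk _
      continuous_invFun := himc.comp (hX11c.comp continuous_subtype_val) }
  have heA : ∀ t, (((eA t : A) : unipDelta L e dV hdV dW hdW) : HA L e dV hdV dW hdW) = n₂ t := fun t => rfl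
  haveI : IsHaarMeasure (μ.map eA) := isHaarMeasure_map_of_homeomorph_add μ eA fun s t => Subtype.ext (hn₂Badd s t)
  -- COCOMPACTNESS of `Γ₁ := N_Δ(L⁺) ⊓ Z` in `Z`
  obtain ⟨C₀, hC₀c, hC₀cov⟩ := exists_isCompact_cover_unipDelta L e dV hdV dW hdW hdV0 hdW0
  have hcover : ∀ b : unipDelta L e dV hdV dW hdW, ∃ γ ∈ unipDeltaRat L e dV hdV dW hdW, ∃ c ∈ C₀, b = γ * c := fun b => by
    obtain ⟨γ, hγ⟩ := hC₀cov b
    exact ⟨((γ⁻¹ : unipDeltaRat L e dV hdV dW hdW) : unipDelta L e dV hdV dW hdW), (γ⁻¹).2, _, hγ, (inv_mul_cancel_left _ _).symm⟩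
  -- finiteness of `κ(Γ) ∩ κ(C₀)`: `κ` factors through `ρ₀` (`κ ∘ ρ₀ = κ`), `ρ₀` maps `Γ = N_Δ(L⁺)` into `H(L⁺)` and `C₀` onto a compact set
  have hκρ₀ : ∀ u, κ (ρ₀ u) = κ u := fun u => by rw [hκ, hκ, hX11ρ₀]
  have hρ₀rat : ∀ γ : unipDelta L e dV hdV dW hdW, γ ∈ unipDeltaRat L e dV hdV dW hdW → (ρ₀ γ : HA L e dV hdV dW hdW) ∈ ratH L e dV hdV dW hdW := by
    intro γ hγ
    obtain ⟨q, hq⟩ := toBlocks₁₂_blk_mem_range_algebraMap L e dV hdV dW hdW ((mem_unipDeltaRat_iff L e dV hdV dW hdW γ).1 hγ) 1 1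
    -- `q` is anti-invariant, hence `q = t δ` with `t ∈ L⁺`, and `im (q ⊗ 1) = t ⊗ 1`
    have hanti := conjAdele_toBlocks₁₂_diag_eq_neg L e dV hdV dW hdW hdV0 hdW0 γ.2 1
    have hanti' : IsCMField.complexConj L q = -q := by
      apply AdeleRing.algebraMap_injective (𝓞 L) L
      refine (algebraMap_conj (Fp L) L (IsCMField.complexConj L) q).trans ?_
      rw [hq, hanti, map_neg, hq]
    -- `t := q / δ ∈ L⁺`, `q = t · δ`, and `im (q ⊗ 1) = t ⊗ 1`
    have ht : IsCMField.complexConj L (q / imagUnit L) = q / imagUnit L := by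
      rw [map_div₀, hanti', complexConj_imagUnit, neg_div_neg_eq]
    set t : Fp L := ⟨q / imagUnit L, (IsCMField.complexConj_eq_self_iff (K := L) _).1 ht⟩ with htdef
    have hqt : algebraMap L (AdeleRing (𝓞 L) L) q =
        AdeleRing.baseChange (Fp L) L (algebraMap (Fp L) (AdeleRing (𝓞 (Fp L)) (Fp L)) t) * algebraMap L (AdeleRing (𝓞 L) L) (imagUnit L) := by
      rw [AdeleRing.baseChange_algebraMap, ← map_mul]
      congr 1
      show q = q / imagUnit L * imagUnit L
      rw [div_mul_cancel₀ _ (imagUnit_ne_zero L)]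
    have him_q : im ((blk L e dV hdV dW hdW (γ : HA L e dV hdV dW hdW)).toBlocks₁₂ 1 1) = algebraMap (Fp L) (AdeleRing (𝓞 (Fp L)) (Fp L)) t := by
      rw [← hq, hqt]
      exact im_baseChange_mul_delta L _
    show n₂ (im _) ∈ ratH L e dV hdV dW hdW
    rw [him_q]
    exact hn₂rat _
  have hfin : ((κ '' (unipDeltaRat L e dV hdV dW hdW : Set (unipDelta L e dV hdV dW hdW))) ∩ (κ '' C₀)).Finite := by
    -- the finite set `H(L⁺) ∩ ρ₀(C₀)` (★ `finite_ratH_inter`), pulled back to `N_Δ(𝔸)` and pushed by `κ`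
    have hF : (((ratH L e dV hdV dW hdW) : Set (HA L e dV hdV dW hdW)) ∩
        ((fun u : unipDelta L e dV hdV dW hdW => (ρ₀ u : HA L e dV hdV dW hdW)) '' C₀)).Finite :=
      finite_ratH_inter L e dV hdV dW hdW (hC₀c.image (continuous_subtype_val.comp hρ₀c))
    have hT : (((↑) : unipDelta L e dV hdV dW hdW → HA L e dV hdV dW hdW) ⁻¹'
        ((((ratH L e dV hdV dW hdW) : Set (HA L e dV hdV dW hdW)) ∩
          ((fun u : unipDelta L e dV hdV dW hdW => (ρ₀ u : HA L e dV hdV dW hdW)) '' C₀)))).Finite :=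
      hF.preimage Subtype.val_injective.injOn
    refine (hT.image κ).subset ?_
    rintro s ⟨⟨γ, hγ, rfl⟩, ⟨c, hc, hγc⟩⟩
    -- `κ γ = κ c` ⇒ `ρ₀ γ = ρ₀ c`; and `κ (ρ₀ γ) = κ γ`
    have hX : (blk L e dV hdV dW hdW (c : HA L e dV hdV dW hdW)).toBlocks₁₂ 1 1 = (blk L e dV hdV dW hdW (γ : HA L e dV hdV dW hdW)).toBlocks₁₂ 1 1 := by
      have h := hγc
      rw [hκ, hκ] at h
      exact Multiplicative.ofAdd.injective h
    have hρeq : ρ₀ c = ρ₀ γ := by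
      show n₂B (im _) = n₂B (im _)
      rw [hX]
    exact ⟨ρ₀ γ, ⟨hρ₀rat γ hγ, c, hc, congrArg Subtype.val hρeq⟩, hκρ₀ γ⟩
  obtain ⟨K, hKc, hKZ, hKcov⟩ := exists_isCompact_cover_inf_of_cover (unipDeltaRat L e dV hdV dW hdW) Z κ hκc
    (fun b => by rw [hZdef, MonoidHom.mem_ker]) hC₀c hcover hfin
  -- `Γ₁ := N_Δ(L⁺) ⊓ Z` (the only subgroup with α3-2's membership law) and a `Γ₁`-weight of finite mass on `Z`
  set Γ₁ : Subgroup (unipDelta L e dV hdV dW hdW) := unipDeltaRat L e dV hdV dW hdW ⊓ Z with hΓ₁def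
  have hle : Γ₁ ≤ Z := inf_le_right
  haveI : Countable Γ₁ := (Subgroup.inclusion_injective (inf_le_left : Γ₁ ≤ unipDeltaRat L e dV hdV dW hdW)).countable
  set K' : Set Z := ((↑) : Z → unipDelta L e dV hdV dW hdW) ⁻¹' K with hK'def
  have hK'c : IsCompact K' := hZc.isClosedEmbedding_subtypeVal.isCompact_preimage hKc
  have hcover' : ∀ z : Z, ∃ γ : Γ₁.subgroupOf Z, γ • z ∈ K' := fun z => by
    obtain ⟨γ, hγ, k, hk, hzk⟩ := hKcov z z.2
    refine ⟨⟨⟨γ⁻¹, hle (inv_mem hγ)⟩, Subgroup.mem_subgroupOf.2 (inv_mem hγ)⟩, ?_⟩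
    have hval : (((⟨γ⁻¹, hle (inv_mem hγ)⟩ : Z) * z : Z) : unipDelta L e dV hdV dW hdW) = k := by
      rw [Subgroup.coe_mul, hzk]
      exact inv_mul_cancel_left γ k
    show (((⟨γ⁻¹, hle (inv_mem hγ)⟩ : Z) * z : Z) : unipDelta L e dV hdV dW hdW) ∈ K
    rw [hval]
    exact hk
  have hfin' : ∀ z : Z, {γ : Γ₁.subgroupOf Z | γ • z ∈ K'}.Finite := fun z => by
    refine finite_smul_mem_of_finite Z Γ₁ hle z ?_
    have h1 : (((↑) : Z → unipDelta L e dV hdV dW hdW) '' K') ⊆ K := by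
      rintro _ ⟨k, hk, rfl⟩
      exact hk
    refine ((finite_unipDeltaRat_smul_mem L e dV hdV dW hdW hKc (z : unipDelta L e dV hdV dW hdW)).preimage
      (Subgroup.inclusion_injective (inf_le_left : Γ₁ ≤ unipDeltaRat L e dV hdV dW hdW)).injOn).subset fun γ hγ => ?_
    exact h1 hγ
  obtain ⟨βZ, hβZ, hβZfin⟩ := exists_isCoveringWeight_lintegral_ne_top Z Γ₁ hle μZ hK'c hfin' hcover'
  obtain ⟨Cst, hC0, hCtop, -, hboch⟩ := exists_unfolding_constant (μ.map eA) μZ νN hsd hAZ Γ₁ hle hβZ hβZfin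
  -- ASSEMBLY
  refine ⟨n₂, Cst, hC0, hCtop, hn₂c, hn₂add, hn₂mem, hn₂X, hn₂rat, ?_⟩
  intro Γ₀ hΓ₀ β₁ hβ₁ E _ _ _ φ hφc hφZ y
  have hΓ : Γ₀ = Γ₁ := by
    ext u
    rw [hΓ₀, hΓ₁def, Subgroup.mem_inf, mem_unipDeltaRat_iff, hZlaw]
  subst hΓ
  have hφ' : Continuous fun b : unipDelta L e dV hdV dW hdW => φ ((b : HA L e dV hdV dW hdW) * y) :=
    hφc.comp (continuous_subtype_val.mul continuous_const)
  have hφ'Z : ∀ (z : Z) (b : unipDelta L e dV hdV dW hdW),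
      φ ((((z : unipDelta L e dV hdV dW hdW) * b : unipDelta L e dV hdV dW hdW) : HA L e dV hdV dW hdW) * y) = φ ((b : HA L e dV hdV dW hdW) * y) :=
    fun z b => by
    rw [Subgroup.coe_mul, mul_assoc]
    exact hφZ _ (z : unipDelta L e dV hdV dW hdW).2 ((hZlaw _).1 z.2) _
  obtain ⟨hiff, hint⟩ := hboch β₁ hβ₁ (fun b => φ ((b : HA L e dV hdV dW hdW) * y)) hφ' hφ'Z
  have htr := integral_map_equiv (μ := μ) eA.toMeasurableEquiv (fun a : A => φ (((a : unipDelta L e dV hdV dW hdW) : HA L e dV hdV dW hdW) * y))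
  have htrI := integrable_map_equiv (μ := μ) eA.toMeasurableEquiv (fun a : A => φ (((a : unipDelta L e dV hdV dW hdW) : HA L e dV hdV dW hdW) * y))
  rw [Homeomorph.toMeasurableEquiv_coe] at htr htrI
  exact ⟨hiff.trans htrI, hint.trans (by rw [htr]; rfl)⟩

end Summit.HodgeConjecture.HodgeConjecture.Cruxes.HLiu418.K2LiuMiddleInnerSectionUnfold

end
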